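import Summits.ValiantsHypothesis.ValiantsHypothesis.Theorems.RigidityForcesSymmetryGrenetFirstOrderRankRigidWordEval

/-!
# Route RigidityForcesSymmetry — `GrenetFirstOrderRankRigid` (item stmt-ValiantsHypothesis-21029),
line `grenet_gauge`: stub `stub_linearRigid`, step 5 — the WINDOW IDENTITY of a tangent direction

For the crux line `Cruxes/GrenetFirstOrderRankRigid/Lines/grenet_gauge.lean` (blueprint
`Lines/grenet_gauge-stub_linearRigid-PROOF.md`, §5, blocks W0 and I=).  For a word
`r : Fin n → Fin n` and a split `s` put `S_s := r({c < s})`, `T_s := r({c > s})ᶜ`, `v_s := (r s, s)`;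
the split is VALID when `r` is injective before and after `s` (`|S_s| = s`, `|r({c > s})| = n-1-s`).
The block of the tangency identity of a homogeneous direction `Σ_v x_v A'_v` with the row-count
weight of `r` and column weight zero (`grenet_tangency_weightSplit`, indicator weights), evaluated at
the point `x_{j,c} = [r c = j]` of `r`, leaves exactly the entries read along `r`
(`grenet_window_identity`):

  `Σ_{s valid} (A'_{v_s}) (row S_s) (col T_s) = 0`.

For a permutation every split is valid (chain sums, block W0); for a word with doubled letters `A`
and missing letters `B`, `|A| = |B| ≥ 1`, the valid splits form the window
`[last first occurrence, first second occurrence]` and the identity TELESCOPES (block I=, file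
`…BlockIeq`).  No new definitions.  VP ≠ VNP is not moved by this file.
-/

noncomputable section

open MvPolynomial Matrix Finset

namespace Summit.ValiantsHypothesis.Theorems.RigidityForcesSymmetry.GrenetGauge

open Literature.Computability.AlgebraicComplexity

/-! ### The window identity -/

section Window

variable {k : Type*} [CommRing k] [IsDomain k] {n N : ℕ} (e : Finset (Fin n) ≃ Fin (N + 1))

/-- **Window identity of a tangent direction.**  Let `Σ_v x_v A'_v` be a homogeneous direction that
is Zariski-tangent at Grenet's pencil and let `r : Fin n → Fin n` be a word.  For the valid splits `s`
(`r` injective on `{c < s}` and on `{c > s}`) pick row indices `ι s` of `r({c<s})` and column indices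
`κ s` of `r({c>s})ᶜ`.  Then `Σ_{s valid} (A'_(r s, s)) (ι s) (κ s) = 0`: the block of row-count weight of
`r` and column weight zero (`grenet_tangency_weightSplit`), evaluated at the point `x_{j,c} = [r c = j]`,
where the surviving entries are exactly those read along `r`. [cite: Grenet2011, Thm. 1] -/
theorem grenet_window_identity (hn : n ≠ 0) (hN : 2 ^ n = N + 1)
    (A' : Fin n × Fin n → Matrix (Fin N) (Fin N) k)
    (htr : ((Grenet.repr k n e).adjugate * ∑ v, (X v : MvPolynomial (Fin n × Fin n) k) • (A' v).map C).trace = 0)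
    (r : Fin n → Fin n) (ι κ : Fin n → Fin N)
    (hι : ∀ s : Fin n, ((univ.filter fun c : Fin n => (c : ℕ) < s).image r).card = s →
      e.symm ((e univ).succAbove (ι s)) = (univ.filter fun c : Fin n => (c : ℕ) < s).image r)
    (hκ : ∀ s : Fin n, ((univ.filter fun c : Fin n => (s : ℕ) < c).image r).card = n - 1 - s →
      e.symm ((e ∅).succAbove (κ s)) = ((univ.filter fun c : Fin n => (s : ℕ) < c).image r)ᶜ) :
    ∑ s ∈ univ.filter (fun s : Fin n => ((univ.filter fun c : Fin n => (c : ℕ) < s).image r).card = s ∧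
        ((univ.filter fun c : Fin n => (s : ℕ) < c).image r).card = n - 1 - s),
      A' (r s, s) (ι s) (κ s) = 0 := by
  classical
  have hRinj : ∀ i i' : Fin N, e.symm ((e univ).succAbove i) = e.symm ((e univ).succAbove i') → i = i' :=
    fun i i' h => Fin.succAbove_right_injective (e.symm.injective h)
  have hCinj : ∀ j j' : Fin N, e.symm ((e ∅).succAbove j) = e.symm ((e ∅).succAbove j') → j = j' :=
    fun j j' h => Fin.succAbove_right_injective (e.symm.injective h)
  -- the block of row-count weight of `r`, column weight zero
  have hblock := grenet_tangency_weightSplit e (fun j => (Pi.single (Sum.inl j) 1 : Fin n ⊕ Fin n → ℕ))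
    (fun c => (Pi.single (Sum.inr c) 1 : Fin n ⊕ Fin n → ℕ)) hn hN A' htr
    (Sum.elim (fun j : Fin n => (univ.filter fun c : Fin n => r c = j).card) (fun _ => 1))
  have h := congrArg (eval (fun v : Fin n × Fin n => if r v.2 = v.1 then (1 : k) else 0)) hblock
  rw [map_sum, map_zero] at h
  -- abbreviations for the prefix / suffix images
  set pre : Fin n → Finset (Fin n) := fun s => (univ.filter fun c : Fin n => (c : ℕ) < s).image r with hpre
  set suf : Fin n → Finset (Fin n) := fun s => (univ.filter fun c : Fin n => (s : ℕ) < c).image r with hsuf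
  -- membership in the block forces `|C j| = |R i| + 1` and `v.2 = |R i|`
  have hmem : ∀ x ∈ (univ : Finset (Fin N × Fin N × (Fin n × Fin n))).filter (fun x =>
      (∑ j ∈ e.symm ((e univ).succAbove x.1), (Pi.single (Sum.inl j) 1 : Fin n ⊕ Fin n → ℕ) +
          ∑ j ∈ (e.symm ((e ∅).succAbove x.2.1))ᶜ, (Pi.single (Sum.inl j) 1 : Fin n ⊕ Fin n → ℕ)) +
        (∑ c ∈ univ.filter (fun c : Fin n => (c : ℕ) < (e.symm ((e univ).succAbove x.1)).card),
            (Pi.single (Sum.inr c) 1 : Fin n ⊕ Fin n → ℕ) +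
          ∑ c ∈ univ.filter (fun c : Fin n => (e.symm ((e ∅).succAbove x.2.1)).card ≤ (c : ℕ)),
            (Pi.single (Sum.inr c) 1 : Fin n ⊕ Fin n → ℕ)) +
        ((Pi.single (Sum.inl x.2.2.1) 1 : Fin n ⊕ Fin n → ℕ) + (Pi.single (Sum.inr x.2.2.2) 1 : Fin n ⊕ Fin n → ℕ))
      = Sum.elim (fun j : Fin n => (univ.filter fun c : Fin n => r c = j).card) (fun _ => 1)),
      (e.symm ((e ∅).succAbove x.2.1)).card = (e.symm ((e univ).succAbove x.1)).card + 1 ∧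
        (x.2.2.2 : ℕ) = (e.symm ((e univ).succAbove x.1)).card := by
    intro x hx
    have hw := (Finset.mem_filter.mp hx).2
    refine colWeight_eq_one_imp ((Finset.card_le_univ _).trans_eq (Fintype.card_fin n))
      ((Finset.card_le_univ _).trans_eq (Fintype.card_fin n)) x.2.2.2 fun c' => ?_
    have := congrFun hw (Sum.inr c')
    rwa [weightE_apply_inr, Sum.elim_inr] at this
  -- each term evaluates to `-(entry) · [x is read along r]`
  have hterm : ∀ x ∈ (univ : Finset (Fin N × Fin N × (Fin n × Fin n))).filter (fun x =>
      (∑ j ∈ e.symm ((e univ).succAbove x.1), (Pi.single (Sum.inl j) 1 : Fin n ⊕ Fin n → ℕ) +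
          ∑ j ∈ (e.symm ((e ∅).succAbove x.2.1))ᶜ, (Pi.single (Sum.inl j) 1 : Fin n ⊕ Fin n → ℕ)) +
        (∑ c ∈ univ.filter (fun c : Fin n => (c : ℕ) < (e.symm ((e univ).succAbove x.1)).card),
            (Pi.single (Sum.inr c) 1 : Fin n ⊕ Fin n → ℕ) +
          ∑ c ∈ univ.filter (fun c : Fin n => (e.symm ((e ∅).succAbove x.2.1)).card ≤ (c : ℕ)),
            (Pi.single (Sum.inr c) 1 : Fin n ⊕ Fin n → ℕ)) +
        ((Pi.single (Sum.inl x.2.2.1) 1 : Fin n ⊕ Fin n → ℕ) + (Pi.single (Sum.inr x.2.2.2) 1 : Fin n ⊕ Fin n → ℕ))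
      = Sum.elim (fun j : Fin n => (univ.filter fun c : Fin n => r c = j).card) (fun _ => 1)),
      eval (fun v : Fin n × Fin n => if r v.2 = v.1 then (1 : k) else 0)
        (C (A' x.2.2 x.1 x.2.1) *
          (perPoly (Fin n) k * (1 - Grenet.adj k n).adjugate (e.symm ((e ∅).succAbove x.2.1))
              (e.symm ((e univ).succAbove x.1)) * X x.2.2
            - (1 - Grenet.adj k n).adjugate ∅ (e.symm ((e univ).succAbove x.1)) * X x.2.2
              * (1 - Grenet.adj k n).adjugate (e.symm ((e ∅).succAbove x.2.1)) univ))
        = -(A' x.2.2 x.1 x.2.1 *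
            if pre x.2.2.2 = e.symm ((e univ).succAbove x.1) ∧ r x.2.2.2 = x.2.2.1 ∧
                (suf x.2.2.2).card = n - 1 - x.2.2.2 ∧ (suf x.2.2.2)ᶜ = e.symm ((e ∅).succAbove x.2.1)
            then 1 else 0) := by
    intro x hx
    obtain ⟨hcard, hq⟩ := hmem x hx
    have hns : ¬ e.symm ((e ∅).succAbove x.2.1) ⊆ e.symm ((e univ).succAbove x.1) := fun hsub => by
      have := Finset.card_le_card hsub; omega
    have hTn : (e.symm ((e ∅).succAbove x.2.1)).card ≤ n := (Finset.card_le_univ _).trans_eq (Fintype.card_fin n)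
    rw [map_mul, eval_C, map_sub, map_mul, map_mul, map_mul, map_mul,
      grenet_W_eq_zero_of_not_subset k hns, map_zero, mul_zero, zero_mul, zero_sub,
      evalWord_grenet_W_empty, eval_X, evalWord_grenet_W_univ k r _ hTn, mul_neg]
    -- compare the two indicator products
    have hpre_eq : (univ.filter fun i : Fin n => (i : ℕ) < (e.symm ((e univ).succAbove x.1)).card).image r
        = pre x.2.2.2 := by simp only [hpre]; rw [hq]
    have hfilt : (univ.filter fun i : Fin n => (e.symm ((e ∅).succAbove x.2.1)).card ≤ (i : ℕ))
        = univ.filter fun c : Fin n => ((x.2.2.2 : Fin n) : ℕ) < c :=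
      Finset.filter_congr fun i _ => by rw [hcard, ← hq]; omega
    have hfilt2 : (univ.filter fun i : Fin n => (e.symm ((e ∅).succAbove x.2.1)).card ≤ (i : ℕ) ∧
        (i : ℕ) < (e.symm ((e ∅).succAbove x.2.1)).card + (n - (e.symm ((e ∅).succAbove x.2.1)).card))
        = univ.filter fun i : Fin n => (e.symm ((e ∅).succAbove x.2.1)).card ≤ (i : ℕ) :=
      Finset.filter_congr fun i _ => by constructor; exact fun h => h.1; exact fun h => ⟨h, by omega⟩
    have himg : univ.image (fun t : Fin (n - (e.symm ((e ∅).succAbove x.2.1)).card) =>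
        r ⟨(e.symm ((e ∅).succAbove x.2.1)).card + (t : ℕ), by omega⟩) = suf x.2.2.2 := by
      rw [image_word_shift r (by omega), hfilt2, hfilt]
    have hiff : (Function.Injective (fun t : Fin (n - (e.symm ((e ∅).succAbove x.2.1)).card) =>
          r ⟨(e.symm ((e ∅).succAbove x.2.1)).card + (t : ℕ), by omega⟩) ∧
        (∀ t : Fin (n - (e.symm ((e ∅).succAbove x.2.1)).card),
          r ⟨(e.symm ((e ∅).succAbove x.2.1)).card + (t : ℕ), by omega⟩ ∉ e.symm ((e ∅).succAbove x.2.1)) ∧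
        e.symm ((e ∅).succAbove x.2.1) ∪ (univ.filter fun i : Fin n =>
          (e.symm ((e ∅).succAbove x.2.1)).card ≤ (i : ℕ)).image r = univ)
        ↔ ((suf x.2.2.2).card = n - 1 - x.2.2.2 ∧ (suf x.2.2.2)ᶜ = e.symm ((e ∅).succAbove x.2.1)) := by
      rw [injective_iff_card_image_eq, himg, hfilt]
      have hsz : n - (e.symm ((e ∅).succAbove x.2.1)).card = n - 1 - x.2.2.2 := by rw [hcard, ← hq]; omega
      constructor
      · rintro ⟨h1, h2, h3⟩
        refine ⟨h1.trans hsz, ?_⟩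
        apply Finset.Subset.antisymm
        · intro y hy
          rw [Finset.mem_compl] at hy
          have hy' : y ∈ e.symm ((e ∅).succAbove x.2.1) ∪ suf x.2.2.2 := by rw [h3]; exact Finset.mem_univ y
          exact (Finset.mem_union.mp hy').resolve_right hy
        · intro y hy
          rw [Finset.mem_compl]
          intro hy'
          rw [← himg] at hy'
          obtain ⟨t, -, rfl⟩ := Finset.mem_image.mp hy'
          exact h2 t hy
      · rintro ⟨h1, h2⟩
        refine ⟨h1.trans hsz.symm, fun t ht => ?_, ?_⟩
        · have hmem : r ⟨(e.symm ((e ∅).succAbove x.2.1)).card + (t : ℕ), by omega⟩ ∈ suf x.2.2.2 := by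
            rw [← himg]; exact Finset.mem_image_of_mem _ (Finset.mem_univ t)
          have ht' : r ⟨(e.symm ((e ∅).succAbove x.2.1)).card + (t : ℕ), by omega⟩ ∈ (suf x.2.2.2)ᶜ := by
            rw [h2]; exact ht
          exact (Finset.mem_compl.mp ht') hmem
        · rw [← h2, Finset.eq_univ_iff_forall]
          intro y
          rw [Finset.mem_union, Finset.mem_compl]
          tauto
    rw [hpre_eq]
    by_cases hP : pre x.2.2.2 = e.symm ((e univ).succAbove x.1) ∧ r x.2.2.2 = x.2.2.1 ∧
        ((suf x.2.2.2).card = n - 1 - x.2.2.2 ∧ (suf x.2.2.2)ᶜ = e.symm ((e ∅).succAbove x.2.1))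
    · obtain ⟨h1, h2, h3⟩ := hP
      rw [if_pos h1, if_pos h2, if_pos (hiff.mpr h3), if_pos ⟨h1, h2, h3⟩]
      simp
    · rw [if_neg hP]
      by_cases h1 : pre x.2.2.2 = e.symm ((e univ).succAbove x.1)
      · by_cases h2 : r x.2.2.2 = x.2.2.1
        · rw [if_neg fun h => hP ⟨h1, h2, hiff.mp h⟩]; ring
        · rw [if_neg h2]; ring
      · rw [if_neg h1]; ring
  rw [Finset.sum_congr rfl hterm, Finset.sum_neg_distrib, neg_eq_zero] at h
  rw [← h]
  symm
  -- reindex by the valid splits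
  set ξ : Fin n → Fin N × Fin N × (Fin n × Fin n) := fun s => (ι s, κ s, (r s, s)) with hξ_def
  have hξinj : Function.Injective ξ := fun s s' h => congrArg (fun x => x.2.2.2) h
  rw [← Finset.sum_subset (s₁ := (univ.filter fun s : Fin n => (pre s).card = s ∧ (suf s).card = n - 1 - s).image ξ)]
  · rw [Finset.sum_image fun s _ s' _ h => hξinj h]
    refine Finset.sum_congr rfl fun s hs => ?_
    obtain ⟨hs1, hs2⟩ := (Finset.mem_filter.mp hs).2
    have e1 : e.symm ((e univ).succAbove (ξ s).1) = pre s := hι s hs1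
    have e2 : e.symm ((e ∅).succAbove (ξ s).2.1) = (suf s)ᶜ := hκ s hs2
    rw [e1, e2, if_pos ⟨rfl, rfl, hs2, rfl⟩, mul_one]
  · intro x hx
    obtain ⟨s, hs, rfl⟩ := Finset.mem_image.mp hx
    obtain ⟨hs1, hs2⟩ := (Finset.mem_filter.mp hs).2
    refine Finset.mem_filter.mpr ⟨Finset.mem_univ _, ?_⟩
    have e1 : e.symm ((e univ).succAbove (ξ s).1) = pre s := hι s hs1
    have e2 : e.symm ((e ∅).succAbove (ξ s).2.1) = (suf s)ᶜ := hκ s hs2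
    have e3 : (ξ s).2.2 = (r s, s) := rfl
    rw [e1, e2, e3]
    exact weightE_window r s hs1 hs2
  · intro x hx hxi
    rw [mul_eq_zero]
    right
    refine if_neg fun hP => hxi ?_
    obtain ⟨h1, h2, h3, h4⟩ := hP
    obtain ⟨-, hq⟩ := hmem x hx
    have hs1 : (pre x.2.2.2).card = x.2.2.2 := by rw [h1, ← hq]
    rw [Finset.mem_image]
    refine ⟨x.2.2.2, Finset.mem_filter.mpr ⟨Finset.mem_univ _, hs1, h3⟩, ?_⟩
    obtain ⟨i, j, v⟩ := x
    refine Prod.ext ?_ (Prod.ext ?_ ?_)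
    · exact hRinj _ _ ((hι v.2 hs1).trans h1)
    · exact hCinj _ _ ((hκ v.2 h3).trans h4)
    · exact Prod.ext h2 rfl

end Window

end Summit.ValiantsHypothesis.Theorems.RigidityForcesSymmetry.GrenetGauge
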